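import Literature.Algebra.Homology.LefschetzNumber
import Literature.Algebra.Homology.EulerCharacteristicTriangle
import Mathlib.Algebra.Homology.HomotopyCategory.HomologicalFunctor
import Mathlib.Algebra.Homology.HomotopyCategory.ShiftSequence
import HarnessLib

/-!
# The Lefschetz number on the homotopy category `K(Vect_K)` (LEAF A of the triangle additivity)

Layer `Literature/Algebra/Homology` (pure linear algebra over Mathlib; ONE data-valued definition + proved theorems, 0 named facts, no
instances, no notation). Row `LefschetzNumber` defines the Lefschetz number `Λ(φ) = Σᶠ χ(i) • tr(H(φ)ᵢ)` of a chain map `φ : C ⟶ C` and shows it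
is a homotopy invariant; this file descends it to Mathlib's homotopy category `HomotopyCategory (ModuleCat K) (ComplexShape.up ℤ)` (objects `X`
with underlying cochain complex `X.as`, morphisms = homotopy classes), through Mathlib's homology functors `HomotopyCategory.homologyFunctor _ _ n`
(which are IRREDUCIBLE in Mathlib; every identification below goes through the factorisation isomorphism `HomotopyCategory.homologyFunctorFactors`):

* `HomotopyCategory.lefschetzNumber f := Σᶠ n, (−1)ⁿ • tr((homologyFunctor n).map f)` for `f : X ⟶ X` — the one definition;
* `trace_homologyFunctor_map_quotient_map`, **`lefschetzNumber_quotient_map : Λ_K((quotient).map φ) = Λ(φ)`** (row `LefschetzNumber`'s number);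
* finiteness transport `moduleFinite_homologyFunctor_obj`, `finrank_homologyFunctor_obj` (`(homologyFunctor n).obj X ≅ Hⁿ(X.as)`);
* `lefschetzNumber_id : Λ_K(𝟙 X) = χ_H(X.as)` (row `LefschetzNumber`'s `lefschetzNumber_id`, BY NAME), `lefschetzNumber_conj` (invariance under
  isomorphism of `K(Vect)`), `lefschetzNumber_comp_comm : Λ_K(f ≫ g) = Λ_K(g ≫ f)`.

LEAF B (`LefschetzNumberTriangle`) proves additivity on distinguished triangles. Library only (cell `pub-hodge-ring2`, count-neutral); proves nothing
about any crux, route or conjecture.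

## References

* A. Hatcher, *Algebraic Topology* (2002), §2.C (Lefschetz number; homotopy invariance). [HatcherAT2002]
* U. Görtz, T. Wedhorn, *Algebraic Geometry II* (2023), Remark 23.62 (2) (additive invariants on the homotopy ∕ derived category). [GortzWedhorn2023]
-/

open CategoryTheory CategoryTheory.Limits

universe v u

namespace Literature.Algebra.Homology.Lefschetz

variable {K : Type u} [Field K]

/-- **The Lefschetz number of an endomorphism in the homotopy category `K(Vect_K)`**: `Λ_K(f) = Σᶠ n, (−1)ⁿ • tr(Hⁿ(f))`, the traces
taken through Mathlib's homology functors on `HomotopyCategory (ModuleCat K) (ComplexShape.up ℤ)`. [cite: HatcherAT2002, §2.C] -/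
noncomputable def HomotopyCategory.lefschetzNumber {X : HomotopyCategory (ModuleCat.{v} K) (ComplexShape.up ℤ)} (f : X ⟶ X) : K :=
  ∑ᶠ n : ℤ, ((ComplexShape.up ℤ).χ n : ℤ) •
    LinearMap.trace K ((HomotopyCategory.homologyFunctor (ModuleCat.{v} K) (ComplexShape.up ℤ) n).obj X)
      ((HomotopyCategory.homologyFunctor (ModuleCat.{v} K) (ComplexShape.up ℤ) n).map f).hom

/-! ### Through the quotient functor -/

section Quotient

variable (C : CochainComplex (ModuleCat.{v} K) ℤ)

/-- The trace of `Hⁿ` of the homotopy class of a chain map `φ` is the trace of `Hⁿ(φ)` (naturality of Mathlib's `homologyFunctorFactors`,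
`LinearMap.trace_conj'`). [cite: HatcherAT2002, §2.C] -/
theorem trace_homologyFunctor_map_quotient_map (φ : C ⟶ C) (n : ℤ) :
    LinearMap.trace K _ ((HomotopyCategory.homologyFunctor (ModuleCat.{v} K) (ComplexShape.up ℤ) n).map
        ((HomotopyCategory.quotient _ _).map φ)).hom =
      LinearMap.trace K _ (HomologicalComplex.homologyMap φ n).hom := by
  let e := (HomotopyCategory.homologyFunctorFactors (ModuleCat.{v} K) (ComplexShape.up ℤ) n).app C
  have h : (HomotopyCategory.homologyFunctor (ModuleCat.{v} K) (ComplexShape.up ℤ) n).map ((HomotopyCategory.quotient _ _).map φ) =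
      e.hom ≫ HomologicalComplex.homologyMap φ n ≫ e.inv := by
    have h' := (Iso.eq_comp_inv e).2 ((HomotopyCategory.homologyFunctorFactors (ModuleCat.{v} K) (ComplexShape.up ℤ) n).hom.naturality φ)
    simp only [Category.assoc, Functor.comp_map] at h'
    exact h'
  rw [h, ← LinearMap.trace_conj' (HomologicalComplex.homologyMap φ n).hom e.toLinearEquiv.symm]
  congr 1

/-- **`Λ_K` of a homotopy class is row `LefschetzNumber`'s Lefschetz number of any representative.** [cite: HatcherAT2002, §2.C] -/
theorem lefschetzNumber_quotient_map (φ : C ⟶ C) :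
    HomotopyCategory.lefschetzNumber ((HomotopyCategory.quotient _ _).map φ) = lefschetzNumber φ :=
  finsum_congr fun n => by rw [trace_homologyFunctor_map_quotient_map]

end Quotient

/-! ### Finiteness transport and the basic calculus -/

variable {X Y : HomotopyCategory (ModuleCat.{v} K) (ComplexShape.up ℤ)}

/-- `(homologyFunctor n).obj X` is finite-dimensional when `Hⁿ(X.as)` is (the factorisation isomorphism). [cite: HatcherAT2002, §2.C] -/
theorem moduleFinite_homologyFunctor_obj (X : HomotopyCategory (ModuleCat.{v} K) (ComplexShape.up ℤ)) (n : ℤ)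
    [Module.Finite K (X.as.homology n)] :
    Module.Finite K ((HomotopyCategory.homologyFunctor (ModuleCat.{v} K) (ComplexShape.up ℤ) n).obj X) :=
  haveI : Module.Finite K ((HomologicalComplex.homologyFunctor (ModuleCat.{v} K) (ComplexShape.up ℤ) n).obj X.as) :=
    inferInstanceAs (Module.Finite K (X.as.homology n))
  Module.Finite.equiv ((HomotopyCategory.homologyFunctorFactors (ModuleCat.{v} K) (ComplexShape.up ℤ) n).app X.as).toLinearEquiv.symm

/-- `dim (homologyFunctor n).obj X = dim Hⁿ(X.as)`. [cite: HatcherAT2002, §2.C] -/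
theorem finrank_homologyFunctor_obj (X : HomotopyCategory (ModuleCat.{v} K) (ComplexShape.up ℤ)) (n : ℤ) :
    Module.finrank K ((HomotopyCategory.homologyFunctor (ModuleCat.{v} K) (ComplexShape.up ℤ) n).obj X) = Module.finrank K (X.as.homology n) :=
  LinearEquiv.finrank_eq ((HomotopyCategory.homologyFunctorFactors (ModuleCat.{v} K) (ComplexShape.up ℤ) n).app X.as).toLinearEquiv

/-- **`Λ_K(𝟙 X) = χ_H(X.as)`** for finite-dimensional finitely supported cohomology (row `LefschetzNumber`'s `lefschetzNumber_id`).
[cite: HatcherAT2002, §2.C] -/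
theorem HomotopyCategory.lefschetzNumber_id (X : HomotopyCategory (ModuleCat.{v} K) (ComplexShape.up ℤ)) [∀ n, Module.Finite K (X.as.homology n)]
    (hH : (GradedObject.finrankSupport fun n => X.as.homology n).Finite) :
    HomotopyCategory.lefschetzNumber (𝟙 X) = (X.as.homologyEulerChar : K) := by
  have h := lefschetzNumber_quotient_map X.as (𝟙 X.as)
  rw [CategoryTheory.Functor.map_id] at h
  exact h.trans (Literature.Algebra.Homology.Lefschetz.lefschetzNumber_id X.as hH)

/-- **Invariance under isomorphism of `K(Vect)`**: `Λ_K(e⁻¹ f e) = Λ_K(f)` (no finiteness needed). [cite: HatcherAT2002, §2.C] -/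
theorem HomotopyCategory.lefschetzNumber_conj (e : X ≅ Y) (f : X ⟶ X) :
    HomotopyCategory.lefschetzNumber (e.inv ≫ f ≫ e.hom) = HomotopyCategory.lefschetzNumber f := by
  refine finsum_congr fun n => ?_
  set F := HomotopyCategory.homologyFunctor (ModuleCat.{v} K) (ComplexShape.up ℤ) n
  rw [← LinearMap.trace_conj' (F.map f).hom (F.mapIso e).toLinearEquiv]
  congr 2
  refine LinearMap.ext fun x => ?_
  rw [LinearEquiv.conj_apply_apply, F.map_comp, F.map_comp]
  rfl

/-- **`Λ_K(f ≫ g) = Λ_K(g ≫ f)`** for `f : X ⟶ Y`, `g : Y ⟶ X` with finite-dimensional cohomology. [cite: HatcherAT2002, §2.C] -/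
theorem HomotopyCategory.lefschetzNumber_comp_comm (f : X ⟶ Y) (g : Y ⟶ X) [∀ n, Module.Finite K (X.as.homology n)]
    [∀ n, Module.Finite K (Y.as.homology n)] :
    HomotopyCategory.lefschetzNumber (f ≫ g) = HomotopyCategory.lefschetzNumber (g ≫ f) := by
  refine finsum_congr fun n => ?_
  haveI := moduleFinite_homologyFunctor_obj X n
  haveI := moduleFinite_homologyFunctor_obj Y n
  rw [Functor.map_comp, Functor.map_comp, ModuleCat.hom_comp, ModuleCat.hom_comp, LinearMap.trace_comp_comm']

end Literature.Algebra.Homology.Lefschetz
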